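import Literature.MathematicalPhysics.QuantumFieldTheory.Balaban1983to89.B2Eq230CondShift
import Literature.MathematicalPhysics.QuantumFieldTheory.Balaban1983to89.B1Ineq234LevelZero

/-!
# `Balaban1983to89.B2Eq230CondShiftBound` — T. Bałaban, *(Higgs)₂,₃ quantum fields in a finite volume. II. An upper bound*,
Commun. Math. Phys. **86** (1982) 555–594 [Balaban1982Higgs2] p. 563: *"Because the fields A′, φ′ are small on ∂Λ₅ …, the
second terms in (2.29), (2.30) can be estimated by O(1)p(ε)"* — **PROVED at the first step on the concrete carrier WITH THE
EXPLICIT (2.34) CONSTANTS of level `0`, for EVERY external field `A`, every Neumann region `Ω`, every conditioning region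
`Λ₅ = B(Λ′)`, uniformly in the site `x` and in the torus**

statement-level skeleton of published theorems with citation tags; proofs where landed; nothing here is a claim about the Yang–Mills mass gap

PDFs held: `paper:balaban1982-cmp86-higgs23-ii` (journal page = PDF page + 554), p. 563 [PDF 9]; `paper:balaban1982-cmp85-higgs23-i`
(journal page = PDF page + 602), pp. 604–605, 610–612 [PDF 2–3, 8–10] — read AS IMAGES on the ×2 renders under
`run/shared/lean/pub/pub-balaban/b2b-balaban-ref1/pages/1982-cmp86-higgs23-II/` and `…/1982-cmp85-higgs23-I/`.

CITATION HEADER (lean-in-tree rule).  lit-balaban typed skeleton (HOME `run/shared/lean/pub/lit-balaban/`), typer line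
(concrete carriers), gen 7, written on the B2 second reader's (r14 g7) knit suggestion of 2026-08-21T10:03Z.  SKELETON row
served: **B2.Eq2.42** ((2.20)–(2.42), fold owner r02, second reader r14), members **(2.29)/(2.30)** p. 563 and the sentence
after them.  NOTHING of record is restated and NOTHING is redefined: the shift IS the typer's `B2Eq230CondShift.condShiftField`
((2.30) `condShiftField_zero_apply`, the mechanism `norm_condShiftField_zero_le`, p259087/p259541), the conditional covariance
IS `HiggsCondCov232.condCov232` (I (2.32)), its coordinate matrix IS p35's `B1Eq230FluctCov.mat` in p34's orthonormal site
coordinates `B1Eq221Coordinates.siteCoord`/`fieldCoord` (basis `cb`), the entrywise decay bound IS r14's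
`B1Ineq234LevelZero.ineq234_levelZero` (p258692: (2.34) at level `0` for every `A`, `Ω`, `Λ`), the constants ARE [B4] §5's
`B4Sect5Torus.cSt`/`dSt` with the profile `B1Ineq234Concrete.profile` and the uniform torus sums ARE `B4Sect5Torus.torusSum_le`
(`B4Sect5Proof.latticeConst` = `K_d`).  This file only COMPOSES them by name.

THE SOURCE TEXT, p. 563 [PDF 9], verbatim.  *"The expression (φ′ − A_Λ⁻¹Aφ↾_{Λᶜ})(x) for vector fields has the form
A′(x) + Σ_{b∈st(Λ₅)} C^{(0)}_{Λ₅}(x, b₋)A′(b₊), x ∈ Λ₅, (2.29) and for scalar fields φ′(x) + Σ_{b∈st(Λ₅)} C^{(0)}_{Λ₅}(B^{(1)};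
x, b₋)U(B_b^{(1)})φ′(b₊), x ∈ Λ₅. (2.30) Because the fields A′, φ′ are small on ∂Λ₅ = {x ∈ Λ₅ᶜ : x = b₊ for some b ∈ st(Λ₅)},
the second terms in (2.29), (2.30) can be estimated by O(1)p(ε) and the characteristic functions χ′ [the expression
(2.29)]·χ′ [the expression (2.30)] can be estimated by the functions χ_{Λ₅}(A′)χ_{Λ₅}(φ′) defined in the same way as χ′ but
with a suitably larger constant O(1). The expressions (2.29), (2.30) occur also in the interaction V^{(0)}(Λ₇), but then
x ∈ Λ₇, and the second terms are of the order O(ε^κ)."* (v1.2: quotation after *"O(1)p(ε)"* corrected to the printed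
continuation — r14 g8 second read 2026-08-21T11:54Z, render p009-x2 re-read by the typer; v1.0/v1.1 had spliced in a
sentence that is not on p. 563).  I p. 611 [PDF 9] (2.34): *"|C^{(k)}_Λ(Ω, A; y, y′)| ≦ c₀ exp(−δ₀|y − y′|),
y, y′ ∈ Λ"*; I p. 610 (2.24): the kernels `G(x, x′)`; I p. 605: `|U(A_b)v| = |v|`; I p. 604 (1.3)/(1.4): the torus distance and
the `d` directions of bonds at a site.

DICTIONARY (print ↦ Lean).  `C^{(0)}_{Λ₅}(B^{(1)}; x, x′)` (an `N × N` real matrix) ↦ `HiggsCovariance.kernel (condCov232 C Ω A m² a 0 Λ) x x′ :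
ℝ^N →ₗ ℝ^N` (unweighted coordinate kernel, `B2Eq230CondShift.apply_eq_sum_kernel`); its matrix ENTRIES in the orthonormal site
coordinates `b = stdOrthonormalBasis ℝ ℝ^N` of p34 ↦ `mat (condCov232 …) (x, i) (x′, j) = ⟪b i, C(x,x′) b j⟫`
(`inner_basis_kernel_basis`); `|y − y′|` ↦ `HiggsLattice.Site.tdist` (lattice units of `T_ε`); `p(ε)` ↦ a bound `p` of
`‖φ′(y)‖` on `∂Λ₅ = bdrySites Ω Λ`; the print's `O(1)` ↦ the explicit number `2d·N·c₁·K_d(δ₁)` below (times the lattice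
factor `ε⁻²` of the unweighted kernel, `= 1` on the unit lattice of the print — see `B2Eq230CondShift`, honest scope (a)).

WHAT THIS FILE PROVES (0 sorry; standard axioms; theorems only, no definition).
§1 (every level `k`, every operator `G`) the kernel ↔ matrix bridge: `cb (x′, j) = δ_{x′}·b j` (`cb_apply_self`,
   `cb_eq_single`), `C(x, x′)(b j) = (G e_{(x′,j)})(x)` (`kernel_basis_eq`), **`⟪b i, G(x,x′) b j⟫ = mat G (x,i) (x′,j)`**
   (`inner_basis_kernel_basis`), and the ENTRYWISE ⇒ OPERATOR-NORM bound **`norm_kernel_le_of_abs_mat_le`**: if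
   `|mat G (x,i) (x′,j)| ≤ m` for all `i, j` (`m ≥ 0`) then `‖G(x,x′)v‖ ≤ N·m·‖v‖` (Parseval in `b` + Cauchy–Schwarz).
§2 (every level) the kernel of `C^{(k)}_Λ(Ω,A)` vanishes off `Λ × Λ` (`kernel_condCov232_apply_of_not_mem_left/right`), and
   the site-level uniform torus sum `Σ_{y∈T^{(k)}} e^{−δ|x−y|} ≤ K_d(δ)` (`sum_exp_neg_tdist_le`, from `torusSum_le`).
§3 (level `0`, r14's (5.4) constant `c₀(δ) = a(Lε)^{−2}e^{δ(L−1)} + (4dε^{−2} + m²)e^{δ}` spelled out as in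
   `B1Ineq234LevelZero`) **`norm_kernel_condCov232_levelZero_le`**: for `m² > 0`, `a ≥ 0`, `0 < K`, every `δ > 0`, EVERY `A`, `Ω`, `Λ`, `x`, `x′`, `v`:
   `‖C^{(0)}_Λ(Ω,A; x, x′)v‖ ≤ N·c₁·e^{−δ₁|x−x′|}·‖v‖`, `(c₁, δ₁) = (cSt, dSt)(profile; m², c₀(δ), δ)` — (2.34) at level `0`
   in operator norm on `ℝ^N`.
§4 (level `0`, `Λ₅ = B(Λ′)`) **the p. 563 sentence with constants**: `norm_condShiftField_zero_le_levelZero` —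
   `‖(second term of (2.30))(x)‖ ≤ ε⁻²·(2d·Σ_{x′} N c₁ e^{−δ₁|x−x′|})·p`, and **`norm_condShiftField_zero_le_uniform`** —
   `‖(second term of (2.30))(x)‖ ≤ ε⁻²·(2d·N·c₁·K_d(δ₁))·p` for EVERY `Ω`, `A`, `Λ′`, `φ′` with `‖φ′‖ ≤ p` on `∂Λ₅`, every `x`,
   on every torus of the model: the print's *"O(1)p(ε)"* with `O(1) = 2d·N·c₁·K_d(δ₁)` independent of `Ω, A, Λ′, φ′, x` and of
   the torus size; (2.29) (vector species, `U ≡ 1`) is the member `A = 0` (`B2Eq230CondShift.condShiftField_zero_field_apply`).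
HONEST SCOPE.  (a) As in `B2Eq230CondShift`: stated on `T_ε` with the unweighted kernel, hence the factor `ε⁻²`; on the unit
lattice `T₁` of the print (`ε = 1` after (1.22)) it is absent.  (b) The constants are r14's level-`0` constants: explicit, but
they carry `m²`, `N`, `L` and the lattice spacing (`ε⁻²` inside `c₀(δ)`), i.e. they are the printed *"O(1)"* only on the unit
lattice; no optimisation in `δ`.  (c) Level `0` only (the nearest-neighbour step (2.30) is a first-step display; `k ≥ 1` is
(2.46)'s business).  (d) `p` is any common bound of `‖φ′(y)‖` on `∂Λ₅`; that the small-field restrictions make it `p(ε)` is the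
content of the characteristic functions (2.7)/(2.55), not asserted here.  Value = the printed estimate made quantitative on the
concrete carrier and consumable by name; NOT summit progress.  Unit `lit-balaban-typer` gen 7
(literature-prover-lit-balaban-typer-g7-0); HOME/FILED.md records the proposal.
-/

open scoped BigOperators InnerProductSpace

namespace Literature.MathematicalPhysics.QuantumFieldTheory.Balaban1983to89.B2Eq230CondShiftBound

open HiggsLattice HiggsCovariance B1Eq221Coordinates B1Eq230FluctCov HiggsCondCov232 B2Eq255Concrete B2Eq230CondShift
open B1Ineq234Concrete (profile profile_nonneg' cb_apply_of_ne mat_apply fieldCoord_cb toT toT_injective sdist sdist_eq_tdist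
  periods one_le_periods)
open B1Ineq234LevelZero (ineq234_levelZero kerConst_levelZero_pos)
open B4Sect5Torus (cSt dSt cSt_pos dSt_pos torusSum_le)

variable {P : HiggsLattice.Params} {N : ℕ} {k : ℕ}

/-! ## §1 The kernel `G(x, x′)` of (2.24) in the orthonormal site coordinates: entries = `mat`, entrywise ⇒ operator norm -/

section KernelMatrix

/-- The coordinate basis field `e_{(x′,j)}` of p35's dictionary takes the value `b j` (the `j`-th vector of the orthonormal
site basis) at its own site. [cite: Balaban1982Higgs1, (1.5) p.604] -/
theorem cb_apply_self (x' : HiggsLattice.Site P k) (j : Ix N) :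
    (cb P N k (x', j)) x' = stdOrthonormalBasis ℝ (E N) j := by
  apply (stdOrthonormalBasis ℝ (E N)).repr.injective
  ext i
  have h := congrFun (fieldCoord_cb (P := P) (N := N) (k := k) (x', j)) (x', i)
  rw [fieldCoord_apply, siteCoord_apply] at h
  rw [h, OrthonormalBasis.repr_self, PiLp.single_apply, Pi.single_apply]
  simp only [Prod.mk.injEq, true_and]

/-- `e_{(x′,j)} = δ_{x′}·(b j)` as a field: a point mass at `x′` with the vector value `b j`.
[cite: Balaban1982Higgs1, (1.5) p.604] -/
theorem cb_eq_single (x' : HiggsLattice.Site P k) (j : Ix N) :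
    (cb P N k (x', j) : ScalarField P k N) = Pi.single x' (stdOrthonormalBasis ℝ (E N) j) := by
  funext y
  by_cases hy : y = x'
  · subst hy
    rw [cb_apply_self, Pi.single_eq_same]
  · rw [cb_apply_of_ne (q := (x', j)) hy, Pi.single_eq_of_ne hy]

/-- `G(x, x′)(b j) = (G e_{(x′,j)})(x)`: the kernel block applied to a basis vector is the image of the coordinate basis
field, read at `x`. [cite: Balaban1982Higgs1, (2.24) p.610] -/
theorem kernel_basis_eq (G : Module.End ℝ (ScalarField P k N)) (x x' : HiggsLattice.Site P k) (j : Ix N) :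
    kernel G x x' (stdOrthonormalBasis ℝ (E N) j) = G (cb P N k (x', j)) x := by
  rw [kernel_apply_single, cb_eq_single]

/-- **The entries of the kernel block are p35's matrix entries**: `⟪b i, G(x, x′) b j⟫ = mat G (x, i) (x′, j)` — the
`N × N` matrix `G(x, x′)` of (2.24) in the orthonormal site coordinates of p. 605 IS the `(x,·),(x′,·)` block of the
coordinate matrix of `G`. [cite: Balaban1982Higgs1, (2.24) p.610] -/
theorem inner_basis_kernel_basis (G : Module.End ℝ (ScalarField P k N)) (x x' : HiggsLattice.Site P k) (i j : Ix N) :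
    ⟪stdOrthonormalBasis ℝ (E N) i, kernel G x x' (stdOrthonormalBasis ℝ (E N) j)⟫_ℝ = mat G (x, i) (x', j) := by
  rw [mat_apply, fieldCoord_apply, siteCoord_apply, OrthonormalBasis.repr_apply_apply, kernel_basis_eq]

/-- The number of internal coordinates is `N`. [cite: Balaban1982Higgs1, (1.5) p.604] -/
theorem card_Ix : (Fintype.card (Ix N) : ℝ) = N := by
  rw [Fintype.card_fin]
  exact_mod_cast (finrank_euclideanSpace_fin : Module.finrank ℝ (E N) = N)

/-- **Entrywise bound ⇒ operator-norm bound for a kernel block**: if `|mat G (x,i) (x′,j)| ≤ m` for all components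
`i, j` (`m ≥ 0`), then `‖G(x, x′)v‖ ≤ N·m·‖v‖` for every `v ∈ ℝ^N` (Parseval in the orthonormal site basis and
Cauchy–Schwarz; the factor `N` is not optimised). [cite: Balaban1982Higgs1, (2.24) p.610] -/
theorem norm_kernel_le_of_abs_mat_le (G : Module.End ℝ (ScalarField P k N)) (x x' : HiggsLattice.Site P k)
    {m : ℝ} (hm0 : 0 ≤ m) (hm : ∀ i j : Ix N, |mat G (x, i) (x', j)| ≤ m) (v : E N) :
    ‖kernel G x x' v‖ ≤ (N : ℝ) * m * ‖v‖ := by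
  set b := stdOrthonormalBasis ℝ (E N) with hb
  set K := kernel G x x' with hK
  have hv : v = ∑ j, ⟪b j, v⟫_ℝ • b j := (b.sum_repr' v).symm
  have hcoef : ∀ i, ⟪b i, K v⟫_ℝ = ∑ j, ⟪b j, v⟫_ℝ * mat G (x, i) (x', j) := by
    intro i
    conv_lhs => rw [hv]
    rw [map_sum, inner_sum]
    refine Finset.sum_congr rfl fun j _ => ?_
    rw [map_smul, real_inner_smul_right, hK, hb, inner_basis_kernel_basis]
  have hparseval : ∀ w : E N, ‖w‖ ^ 2 = ∑ i, ⟪b i, w⟫_ℝ ^ 2 := by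
    intro w
    rw [← real_inner_self_eq_norm_sq, ← b.sum_inner_mul_inner w w]
    refine Finset.sum_congr rfl fun i _ => ?_
    rw [sq, real_inner_comm]
  have hci : ∀ i, ⟪b i, K v⟫_ℝ ^ 2 ≤ ‖v‖ ^ 2 * ((N : ℝ) * m ^ 2) := by
    intro i
    rw [hcoef i, hparseval v]
    refine (Finset.sum_mul_sq_le_sq_mul_sq _ _ _).trans ?_
    refine mul_le_mul_of_nonneg_left ?_ (Finset.sum_nonneg fun j _ => sq_nonneg _)
    calc ∑ j, mat G (x, i) (x', j) ^ 2 ≤ ∑ _j : Ix N, m ^ 2 :=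
          Finset.sum_le_sum fun j _ => sq_le_sq.mpr ((hm i j).trans (le_abs_self m))
      _ = (N : ℝ) * m ^ 2 := by rw [Finset.sum_const, Finset.card_univ, nsmul_eq_mul, card_Ix]
  have hsq : ‖K v‖ ^ 2 ≤ ((N : ℝ) * m * ‖v‖) ^ 2 := by
    calc ‖K v‖ ^ 2 = ∑ i, ⟪b i, K v⟫_ℝ ^ 2 := hparseval (K v)
      _ ≤ ∑ _i : Ix N, ‖v‖ ^ 2 * ((N : ℝ) * m ^ 2) := Finset.sum_le_sum fun i _ => hci i
      _ = ((N : ℝ) * m * ‖v‖) ^ 2 := by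
          rw [Finset.sum_const, Finset.card_univ, nsmul_eq_mul, card_Ix]; ring
  exact (sq_le_sq₀ (norm_nonneg _) (mul_nonneg (mul_nonneg (Nat.cast_nonneg N) hm0) (norm_nonneg v))).mp hsq

end KernelMatrix

/-! ## §2 The kernel of `C^{(k)}_Λ(Ω, A)` lives on `Λ × Λ`; uniform torus sums at the site level -/

section Support

variable (C : ChargeData N) (Ω : Finset (HiggsLattice.Site P 0)) (A : HiggsLattice.VecField P 0) (msq a : ℝ)

/-- `C^{(k)}_Λ(Ω,A; x, x′) = 0` for `x ∉ Λ` (a configuration on `Λ`, (2.32)). [cite: Balaban1982Higgs1, (2.32) p.611] -/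
theorem kernel_condCov232_apply_of_not_mem_left (Λ : Finset (HiggsLattice.Site P k)) {x : HiggsLattice.Site P k}
    (hx : x ∉ Λ) (x' : HiggsLattice.Site P k) (v : E N) : kernel (condCov232 C Ω A msq a k Λ) x x' v = 0 := by
  rw [kernel_apply_single]
  exact condCov232_apply_of_not_mem C Ω A msq a k Λ _ hx

/-- `C^{(k)}_Λ(Ω,A; x, x′) = 0` for `x′ ∉ Λ` (`C^{(k)}_Λ` reads only the part of its argument on `Λ`, (2.32)).
[cite: Balaban1982Higgs1, (2.32) p.611] -/
theorem kernel_condCov232_apply_of_not_mem_right (Λ : Finset (HiggsLattice.Site P k)) (x : HiggsLattice.Site P k)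
    {x' : HiggsLattice.Site P k} (hx' : x' ∉ Λ) (v : E N) : kernel (condCov232 C Ω A msq a k Λ) x x' v = 0 := by
  rw [kernel_apply_single, ← condCov232_cutTo]
  have h0 : cutTo Λ (Pi.single x' v : ScalarField P k N) = 0 := by
    funext y
    by_cases hy : y ∈ Λ
    · have hne : y ≠ x' := fun h => hx' (h ▸ hy)
      rw [cutTo_of_mem Λ _ hy, Pi.single_eq_of_ne hne]
      rfl
    · exact cutTo_of_not_mem Λ _ hy
  rw [h0, map_zero]
  rfl

end Support

/-- **Uniform torus sums at the site level**: `Σ_{y ∈ T^{(k)}} e^{−δ|x − y|} ≤ K_d(δ) = (2(1 − e^{−δ/d})⁻¹)^d` for every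
`δ > 0` and every site `x`, on EVERY torus `T^{(k)}` of the model (distance (1.3) in lattice units; [B4] §5's `torusSum_le`
pulled back along `B1Ineq234Concrete.toT`). [cite: Balaban1983RegularityDecay, Sect. 5 Theorem p.594] -/
theorem sum_exp_neg_tdist_le {δ : ℝ} (hδ : 0 < δ) (x : HiggsLattice.Site P k) :
    ∑ y : HiggsLattice.Site P k, Real.exp (-(δ * (HiggsLattice.Site.tdist x y : ℝ)))
      ≤ B4Sect5Proof.latticeConst P.d δ := by
  have h1 : ∀ y : HiggsLattice.Site P k, Real.exp (-(δ * (HiggsLattice.Site.tdist x y : ℝ)))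
      = Real.exp (-(δ * B4Sect5Torus.tdist (periods P k) (toT x) (toT y))) := by
    intro y
    rw [← sdist_eq_tdist]
    rfl
  simp_rw [h1]
  calc ∑ y : HiggsLattice.Site P k, Real.exp (-(δ * B4Sect5Torus.tdist (periods P k) (toT x) (toT y)))
      = ∑ z ∈ Finset.univ.image (toT (P := P) (k := k)),
          Real.exp (-(δ * B4Sect5Torus.tdist (periods P k) (toT x) z)) :=
        (Finset.sum_image (f := fun z => Real.exp (-(δ * B4Sect5Torus.tdist (periods P k) (toT x) z)))
          toT_injective.injOn).symm
    _ ≤ ∑ z, Real.exp (-(δ * B4Sect5Torus.tdist (periods P k) (toT x) z)) :=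
        Finset.sum_le_univ_sum_of_nonneg fun _ => (Real.exp_pos _).le
    _ ≤ B4Sect5Proof.latticeConst P.d δ := torusSum_le P.d (one_le_periods P k) hδ (toT x)

/-! ## §3 (2.34) at level `0` in operator norm on `ℝ^N`, for every `A`, `Ω`, `Λ` -/

section LevelZero

variable (C : ChargeData N) (Ω : Finset (HiggsLattice.Site P 0)) (A : HiggsLattice.VecField P 0) (msq a : ℝ)

/-- The (2.34) constant `c₁ = cSt(profile; m², c₀(δ), δ)` of level `0` is positive (`m² > 0`).
[cite: Balaban1982Higgs1, Prop. 2.3 (2.34) p.611] -/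
theorem cSt_levelZero_pos (hmsq : 0 < msq) (δ : ℝ) :
    0 < cSt (profile P N) msq
          (a * ((P.mesh (0 + 1))⁻¹ ^ 2) * Real.exp (δ * ((P.L : ℝ) - 1)) +
            (4 * P.d * (P.mesh 0)⁻¹ ^ 2 + msq) * Real.exp δ) δ :=
  cSt_pos _ _ _ hmsq

/-- The (2.34) rate `δ₁ = dSt(profile; m², c₀(δ), δ)` of level `0` is positive (`m² > 0`, `a ≥ 0`, `δ > 0`).
[cite: Balaban1982Higgs1, Prop. 2.3 (2.34) p.611] -/
theorem dSt_levelZero_pos (ha : 0 ≤ a) (hmsq : 0 < msq) {δ : ℝ} (hδ : 0 < δ) :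
    0 < dSt (profile P N) msq
          (a * ((P.mesh (0 + 1))⁻¹ ^ 2) * Real.exp (δ * ((P.L : ℝ) - 1)) +
            (4 * P.d * (P.mesh 0)⁻¹ ^ 2 + msq) * Real.exp δ) δ :=
  dSt_pos profile_nonneg' hmsq (kerConst_levelZero_pos (P := P) msq a ha hmsq δ).le hδ

/-- **(2.34) AT LEVEL `0` IN OPERATOR NORM, for EVERY `A`, `Ω`, `Λ`, `x`, `x′`**: for `m² > 0`, `a ≥ 0`, `0 < K`, every
`δ > 0` and every `v ∈ ℝ^N`, `‖C^{(0),ε}_Λ(Ω, A; x, x′)v‖ ≤ N·c₁·e^{−δ₁|x − x′|}·‖v‖` with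
`(c₁, δ₁) = (cSt, dSt)(profile; m², c₀(δ), δ)`, `c₀(δ) = a(Lε)^{−2}e^{δ(L−1)} + (4dε^{−2} + m²)e^{δ}` — r14's entrywise
`ineq234_levelZero` on `Λ × Λ` through §1, and `0` off `Λ × Λ` (§2). [cite: Balaban1982Higgs1, Prop. 2.3 (2.34) p.611] -/
theorem norm_kernel_condCov232_levelZero_le (hK : 0 < P.K) (ha : 0 ≤ a) (hmsq : 0 < msq) {δ : ℝ} (hδ : 0 < δ)
    (Λ : Finset (HiggsLattice.Site P 0)) (x x' : HiggsLattice.Site P 0) (v : E N) :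
    ‖kernel (condCov232 C Ω A msq a 0 Λ) x x' v‖ ≤
      (N : ℝ) * (cSt (profile P N) msq
          (a * ((P.mesh (0 + 1))⁻¹ ^ 2) * Real.exp (δ * ((P.L : ℝ) - 1)) +
            (4 * P.d * (P.mesh 0)⁻¹ ^ 2 + msq) * Real.exp δ) δ *
        Real.exp (-(dSt (profile P N) msq
          (a * ((P.mesh (0 + 1))⁻¹ ^ 2) * Real.exp (δ * ((P.L : ℝ) - 1)) +
            (4 * P.d * (P.mesh 0)⁻¹ ^ 2 + msq) * Real.exp δ) δ *
          (HiggsLattice.Site.tdist x x' : ℝ)))) * ‖v‖ := by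
  have hm0 : 0 ≤ cSt (profile P N) msq
          (a * ((P.mesh (0 + 1))⁻¹ ^ 2) * Real.exp (δ * ((P.L : ℝ) - 1)) +
            (4 * P.d * (P.mesh 0)⁻¹ ^ 2 + msq) * Real.exp δ) δ *
        Real.exp (-(dSt (profile P N) msq
          (a * ((P.mesh (0 + 1))⁻¹ ^ 2) * Real.exp (δ * ((P.L : ℝ) - 1)) +
            (4 * P.d * (P.mesh 0)⁻¹ ^ 2 + msq) * Real.exp δ) δ *
          (HiggsLattice.Site.tdist x x' : ℝ))) :=
    mul_nonneg (cSt_levelZero_pos (P := P) (N := N) msq a hmsq δ).le (Real.exp_pos _).le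
  by_cases hx : x ∈ Λ
  · by_cases hx' : x' ∈ Λ
    · refine norm_kernel_le_of_abs_mat_le _ x x' hm0 (fun i j => ?_) v
      exact ineq234_levelZero C Ω A msq a hK ha hmsq hδ Λ (p := (x, i)) (q := (x', j)) hx hx'
    · rw [kernel_condCov232_apply_of_not_mem_right C Ω A msq a Λ x hx', norm_zero]
      exact mul_nonneg (mul_nonneg (Nat.cast_nonneg N) hm0) (norm_nonneg v)
  · rw [kernel_condCov232_apply_of_not_mem_left C Ω A msq a Λ hx, norm_zero]
    exact mul_nonneg (mul_nonneg (Nat.cast_nonneg N) hm0) (norm_nonneg v)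

/-! ## §4 p. 563 *"the second terms in (2.29), (2.30) can be estimated by O(1)p(ε)"* with the level-`0` constants -/

/-- **p. 563 with constants, per site**: for `m² > 0`, `a ≥ 0`, `0 < K`, `δ > 0`, EVERY `A`, `Ω`, `Λ₅ = B(Λ′)` and every
`φ′` with `‖φ′(y)‖ ≤ p` on `∂Λ₅`, at every site `x`:
`‖(second term of (2.30))(x)‖ ≤ ε⁻²·(2d·Σ_{x′∈T_ε} N·c₁e^{−δ₁|x−x′|})·p` (§3 fed into the mechanism
`B2Eq230CondShift.norm_condShiftField_zero_le`). [cite: Balaban1982Higgs2, (2.30) p.563] -/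
theorem norm_condShiftField_zero_le_levelZero (hK : 0 < P.K) (ha : 0 ≤ a) (hmsq : 0 < msq) {δ : ℝ} (hδ : 0 < δ)
    (Λ' : Finset (HiggsLattice.Site P 1)) {φ : ScalarField P 0 N} {p : ℝ} (hp : 0 ≤ p)
    (hφ : ∀ y ∈ bdrySites Ω (HiggsLattice.blockSet Λ'), ‖φ y‖ ≤ p) (x : HiggsLattice.Site P 0) :
    ‖condShiftField C Ω A msq a 0 (HiggsLattice.blockSet Λ') φ x‖
      ≤ (P.mesh 0)⁻¹ ^ 2 * (2 * (P.d : ℝ) * ∑ x' : HiggsLattice.Site P 0,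
          (N : ℝ) * (cSt (profile P N) msq
              (a * ((P.mesh (0 + 1))⁻¹ ^ 2) * Real.exp (δ * ((P.L : ℝ) - 1)) +
                (4 * P.d * (P.mesh 0)⁻¹ ^ 2 + msq) * Real.exp δ) δ *
            Real.exp (-(dSt (profile P N) msq
              (a * ((P.mesh (0 + 1))⁻¹ ^ 2) * Real.exp (δ * ((P.L : ℝ) - 1)) +
                (4 * P.d * (P.mesh 0)⁻¹ ^ 2 + msq) * Real.exp δ) δ *
              (HiggsLattice.Site.tdist x x' : ℝ))))) * p :=
  norm_condShiftField_zero_le C Ω A msq a Λ'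
    (fun x x' v => norm_kernel_condCov232_levelZero_le C Ω A msq a hK ha hmsq hδ _ x x' v)
    (fun _ _ => mul_nonneg (Nat.cast_nonneg N)
      (mul_nonneg (cSt_levelZero_pos (P := P) (N := N) msq a hmsq δ).le (Real.exp_pos _).le)) hp hφ x

/-- **p. 563, *"the second terms in (2.29), (2.30) can be estimated by O(1)p(ε)"*, WITH AN EXPLICIT `O(1)` UNIFORM IN
`Ω, A, Λ′, φ′, x` AND IN THE TORUS**: for `m² > 0`, `a ≥ 0`, `0 < K`, `δ > 0`,
`‖(second term of (2.30))(x)‖ ≤ ε⁻²·(2d·N·c₁·K_d(δ₁))·p` whenever `‖φ′(y)‖ ≤ p` on `∂Λ₅` (`Λ₅ = B(Λ′)`),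
`(c₁, δ₁) = (cSt, dSt)(profile; m², c₀(δ), δ)`, `K_d = B4Sect5Proof.latticeConst P.d` (uniform torus sums, §2); the vector
species (2.29) is the member `A = 0`. [cite: Balaban1982Higgs2, (2.30) p.563] -/
theorem norm_condShiftField_zero_le_uniform (hK : 0 < P.K) (ha : 0 ≤ a) (hmsq : 0 < msq) {δ : ℝ} (hδ : 0 < δ)
    (Λ' : Finset (HiggsLattice.Site P 1)) {φ : ScalarField P 0 N} {p : ℝ} (hp : 0 ≤ p)
    (hφ : ∀ y ∈ bdrySites Ω (HiggsLattice.blockSet Λ'), ‖φ y‖ ≤ p) (x : HiggsLattice.Site P 0) :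
    ‖condShiftField C Ω A msq a 0 (HiggsLattice.blockSet Λ') φ x‖
      ≤ (P.mesh 0)⁻¹ ^ 2 * (2 * (P.d : ℝ) * ((N : ℝ) * (cSt (profile P N) msq
              (a * ((P.mesh (0 + 1))⁻¹ ^ 2) * Real.exp (δ * ((P.L : ℝ) - 1)) +
                (4 * P.d * (P.mesh 0)⁻¹ ^ 2 + msq) * Real.exp δ) δ *
          B4Sect5Proof.latticeConst P.d (dSt (profile P N) msq
              (a * ((P.mesh (0 + 1))⁻¹ ^ 2) * Real.exp (δ * ((P.L : ℝ) - 1)) +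
                (4 * P.d * (P.mesh 0)⁻¹ ^ 2 + msq) * Real.exp δ) δ)))) * p := by
  refine (norm_condShiftField_zero_le_levelZero C Ω A msq a hK ha hmsq hδ Λ' hp hφ x).trans ?_
  have hsum : ∑ x' : HiggsLattice.Site P 0,
      (N : ℝ) * (cSt (profile P N) msq
              (a * ((P.mesh (0 + 1))⁻¹ ^ 2) * Real.exp (δ * ((P.L : ℝ) - 1)) +
                (4 * P.d * (P.mesh 0)⁻¹ ^ 2 + msq) * Real.exp δ) δ *
        Real.exp (-(dSt (profile P N) msq
              (a * ((P.mesh (0 + 1))⁻¹ ^ 2) * Real.exp (δ * ((P.L : ℝ) - 1)) +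
                (4 * P.d * (P.mesh 0)⁻¹ ^ 2 + msq) * Real.exp δ) δ *
              (HiggsLattice.Site.tdist x x' : ℝ))))
      ≤ (N : ℝ) * (cSt (profile P N) msq
              (a * ((P.mesh (0 + 1))⁻¹ ^ 2) * Real.exp (δ * ((P.L : ℝ) - 1)) +
                (4 * P.d * (P.mesh 0)⁻¹ ^ 2 + msq) * Real.exp δ) δ *
          B4Sect5Proof.latticeConst P.d (dSt (profile P N) msq
              (a * ((P.mesh (0 + 1))⁻¹ ^ 2) * Real.exp (δ * ((P.L : ℝ) - 1)) +
                (4 * P.d * (P.mesh 0)⁻¹ ^ 2 + msq) * Real.exp δ) δ)) := by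
    rw [← Finset.mul_sum, ← Finset.mul_sum]
    exact mul_le_mul_of_nonneg_left
      (mul_le_mul_of_nonneg_left (sum_exp_neg_tdist_le (dSt_levelZero_pos (P := P) (N := N) msq a ha hmsq hδ) x)
        (cSt_levelZero_pos (P := P) (N := N) msq a hmsq δ).le)
      (Nat.cast_nonneg N)
  have hε : 0 ≤ (P.mesh 0)⁻¹ ^ 2 := pow_nonneg (inv_nonneg.mpr (P.mesh_pos 0).le) 2
  have hd : 0 ≤ 2 * (P.d : ℝ) := by positivity
  exact mul_le_mul_of_nonneg_right (mul_le_mul_of_nonneg_left (mul_le_mul_of_nonneg_left hsum hd) hε) hp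

end LevelZero

/-! ## §5 (v1.1, typer gen 8) (2.36) and (2.38) at level `0` in operator norm on `ℝ^N`

I p. 611–612 [PDF 9–10], Prop. 2.3, verbatim: *"Putting δC^{(k)}_Λ(Ω, A) = C^{(k)}_Λ(Ω, A) − C^{(k)}(Ω, A), (2.35) we have
|δC^{(k)}_Λ(Ω, A; x, x′)| ≦ c₀exp(−δ₀(|x − x′| + dist(x, Λᶜ) + dist(x′, Λᶜ))), x, x′ ∈ Λ. (2.36) … If Ω ⊂ Ω₀ … then
|C^{(k)}_Λ(Ω, A; x, x′) − C^{(k)}_Λ(Ω₀, A; x, x′)| ≦ c₀exp(−δ₀(dist(x, Ωᶜ) + |x − x′| + dist(x′, Ωᶜ))) (2.38)"*.  r14's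
ENTRYWISE level-`0` theorems `B1Ineq234LevelZero.ineq236_levelZero` / `ineq238_levelZero` (p258692 / p259015; every `A`, `Ω`,
`Λ`, resp. every `Ω ⊆ Ω₀`) composed with §1's `norm_kernel_le_of_abs_mat_le` exactly as §3 does for (2.34): the same
constants, `N·c₁` in front, the boundary weights `dist(·, Λᶜ)` = `B1Ineq234Concrete.distC Λ` resp. `distC Ω` (lattice units). -/

section LevelZeroCompanions

open B1Ineq234LevelZero (ineq236_levelZero ineq238_levelZero)
open B1Ineq234Concrete (distC)

variable (C : ChargeData N) (Ω : Finset (HiggsLattice.Site P 0)) (A : HiggsLattice.VecField P 0) (msq a : ℝ)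

/-- The kernel block (2.24) is additive in the operator: `(G − G′)(x, x′) = G(x, x′) − G′(x, x′)`. [cite: Balaban1982Higgs1, (2.24) p.610] -/
theorem kernel_sub (G G' : Module.End ℝ (ScalarField P k N)) (x x' : HiggsLattice.Site P k) :
    kernel (G - G') x x' = kernel G x x' - kernel G' x x' := by
  simp only [kernel, LinearMap.comp_sub, LinearMap.sub_comp]

/-- The matrix entries of a difference are the differences of the entries. [cite: Balaban1982Higgs1, (1.5) p.604] -/
theorem mat_sub_apply (G G' : Module.End ℝ (ScalarField P k N)) (p q : HiggsLattice.Site P k × Ix N) :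
    mat (G - G') p q = mat G p q - mat G' p q := by
  rw [mat_sub, Matrix.sub_apply]

/-- **(2.36) AT LEVEL `0` IN OPERATOR NORM, for EVERY `A`, `Ω`, `Λ` and `x, x′ ∈ Λ`**: for `m² > 0`, `a ≥ 0`, `0 < K`,
every `δ > 0` and every `v ∈ ℝ^N`,
`‖δC^{(0),ε}_Λ(Ω, A; x, x′)v‖ ≤ N·c₁·e^{−δ₁(|x − x′| + dist(x, Λᶜ) + dist(x′, Λᶜ))}·‖v‖`, `(c₁, δ₁) = (cSt, dSt)(profile; m²,
c₀(δ), δ)` as in §3 (`δC^{(0)}_Λ` = the typer's `HiggsCondCov232.deltaCov235`; entrywise input = r14's `ineq236_levelZero`).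
As printed, only on `Λ × Λ` (off `Λ` the `C^{(0)}(Ω, A)` part of `δC` does not carry the boundary damping). [cite: Balaban1982Higgs1, Prop. 2.3 (2.36) p.612] -/
theorem norm_kernel_deltaCov235_levelZero_le (hK : 0 < P.K) (ha : 0 ≤ a) (hmsq : 0 < msq) {δ : ℝ} (hδ : 0 < δ)
    (Λ : Finset (HiggsLattice.Site P 0)) {x x' : HiggsLattice.Site P 0} (hx : x ∈ Λ) (hx' : x' ∈ Λ) (v : E N) :
    ‖kernel (deltaCov235 C Ω A msq a 0 Λ) x x' v‖ ≤
      (N : ℝ) * (cSt (profile P N) msq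
          (a * ((P.mesh (0 + 1))⁻¹ ^ 2) * Real.exp (δ * ((P.L : ℝ) - 1)) +
            (4 * P.d * (P.mesh 0)⁻¹ ^ 2 + msq) * Real.exp δ) δ *
        Real.exp (-(dSt (profile P N) msq
          (a * ((P.mesh (0 + 1))⁻¹ ^ 2) * Real.exp (δ * ((P.L : ℝ) - 1)) +
            (4 * P.d * (P.mesh 0)⁻¹ ^ 2 + msq) * Real.exp δ) δ *
          ((HiggsLattice.Site.tdist x x' : ℝ) + distC Λ x + distC Λ x')))) * ‖v‖ :=
  norm_kernel_le_of_abs_mat_le _ x x'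
    (mul_nonneg (cSt_levelZero_pos (P := P) (N := N) msq a hmsq δ).le (Real.exp_pos _).le)
    (fun i j => ineq236_levelZero C Ω A msq a hK ha hmsq hδ Λ (p := (x, i)) (q := (x', j)) hx hx') v

variable {Ω} {Ω₀ : Finset (HiggsLattice.Site P 0)}

/-- **(2.38) AT LEVEL `0` IN OPERATOR NORM, for EVERY `A`, every `Ω ⊆ Ω₀`, every `Λ` and ALL sites `x, x′`**: for `m² > 0`,
`a ≥ 0`, `0 < K`, every `δ > 0` and every `v ∈ ℝ^N`,
`‖(C^{(0),ε}_Λ(Ω, A; x, x′) − C^{(0),ε}_Λ(Ω₀, A; x, x′))v‖ ≤ N·c₁′·e^{−δ₁′(|x − x′| + dist(x, Ωᶜ) + dist(x′, Ωᶜ))}·‖v‖` with the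
(2.38) constants `(c₁′, δ₁′) = (cSt, dSt)(profile; m², c₀′(δ), δ)`, `c₀′(δ) = a(Lε)^{−2}e^{δ(L−1)} + (4dε^{−2} + m²)(e^{δ} + 2e^{3δ})`
of r14's `ineq238_levelZero` (entrywise on `Λ × Λ`); off `Λ × Λ` both kernels vanish (§2), so the bound holds at all sites.
[cite: Balaban1982Higgs1, Prop. 2.3 (2.38) p.612] -/
theorem norm_kernel_condCov232_sub_levelZero_le (hΩ : Ω ⊆ Ω₀) (hK : 0 < P.K) (ha : 0 ≤ a) (hmsq : 0 < msq) {δ : ℝ}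
    (hδ : 0 < δ) (Λ : Finset (HiggsLattice.Site P 0)) (x x' : HiggsLattice.Site P 0) (v : E N) :
    ‖kernel (condCov232 C Ω A msq a 0 Λ) x x' v - kernel (condCov232 C Ω₀ A msq a 0 Λ) x x' v‖ ≤
      (N : ℝ) * (cSt (profile P N) msq
          (a * ((P.mesh (0 + 1))⁻¹ ^ 2) * Real.exp (δ * ((P.L : ℝ) - 1)) +
            (4 * P.d * (P.mesh 0)⁻¹ ^ 2 + msq) * (Real.exp δ + 2 * Real.exp (3 * δ))) δ *
        Real.exp (-(dSt (profile P N) msq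
          (a * ((P.mesh (0 + 1))⁻¹ ^ 2) * Real.exp (δ * ((P.L : ℝ) - 1)) +
            (4 * P.d * (P.mesh 0)⁻¹ ^ 2 + msq) * (Real.exp δ + 2 * Real.exp (3 * δ))) δ *
          ((HiggsLattice.Site.tdist x x' : ℝ) + distC Ω x + distC Ω x')))) * ‖v‖ := by
  have hm0 : 0 ≤ cSt (profile P N) msq
          (a * ((P.mesh (0 + 1))⁻¹ ^ 2) * Real.exp (δ * ((P.L : ℝ) - 1)) +
            (4 * P.d * (P.mesh 0)⁻¹ ^ 2 + msq) * (Real.exp δ + 2 * Real.exp (3 * δ))) δ *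
        Real.exp (-(dSt (profile P N) msq
          (a * ((P.mesh (0 + 1))⁻¹ ^ 2) * Real.exp (δ * ((P.L : ℝ) - 1)) +
            (4 * P.d * (P.mesh 0)⁻¹ ^ 2 + msq) * (Real.exp δ + 2 * Real.exp (3 * δ))) δ *
          ((HiggsLattice.Site.tdist x x' : ℝ) + distC Ω x + distC Ω x'))) :=
    mul_nonneg (cSt_pos _ _ _ hmsq).le (Real.exp_pos _).le
  rw [← LinearMap.sub_apply, ← kernel_sub]
  by_cases hx : x ∈ Λ
  · by_cases hx' : x' ∈ Λ
    · refine norm_kernel_le_of_abs_mat_le _ x x' hm0 (fun i j => ?_) v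
      rw [mat_sub_apply]
      exact ineq238_levelZero C A msq a hΩ hK ha hmsq hδ Λ (p := (x, i)) (q := (x', j)) hx hx'
    · rw [kernel_sub, LinearMap.sub_apply, kernel_condCov232_apply_of_not_mem_right C Ω A msq a Λ x hx',
        kernel_condCov232_apply_of_not_mem_right C Ω₀ A msq a Λ x hx', sub_zero, norm_zero]
      exact mul_nonneg (mul_nonneg (Nat.cast_nonneg N) hm0) (norm_nonneg v)
  · rw [kernel_sub, LinearMap.sub_apply, kernel_condCov232_apply_of_not_mem_left C Ω A msq a Λ hx,
      kernel_condCov232_apply_of_not_mem_left C Ω₀ A msq a Λ hx, sub_zero, norm_zero]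
    exact mul_nonneg (mul_nonneg (Nat.cast_nonneg N) hm0) (norm_nonneg v)

end LevelZeroCompanions

/-! ## §6 (v1.2, typer gen 9) p. 563: the shift AWAY from `∂Λ₅` — *"The expressions (2.29), (2.30) occur also in the
interaction V^{(0)}(Λ₇), but then x ∈ Λ₇, and the second terms are of the order O(ε^κ)"*

The mechanism of `B2Eq230CondShift.norm_condShiftField_zero_le` summed the entrywise domination `c(x, x′)` over ALL sites `x′`;
kept over the SOURCES `b₋` of the boundary bonds only (`norm_condShiftField_zero_le_sources`), an exponentially decaying
domination `c₁e^{−δ₁|x − x′|}` gives the factor `e^{−(δ₁/2)(D − 1)}` at a site `x` whose distance from `Λ₅ᶜ` is `≥ D`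
(`norm_condShiftField_zero_le_far`: every source is a neighbour of a point of `∂Λ₅ ⊂ Λ₅ᶜ`, hence at distance `≥ D − 1` from
`x`; half of the decay is spent on the distance, the other half on the uniform torus sum `K_d(δ₁/2)` of §2).  For `x ∈ Λ₇` the
separation (2.8) gives `D > r(ε)` (`B2Eq28RegionsConcrete.sep_region`/`lt_distC_region_of_lt`), so the factor is
`≤ e^{−(δ₁/2)·r(ε)}` (`norm_condShiftField_zero_le_far_of_le`), which is `≤ C_κ ε^κ` for every `κ` once `δ₁` is uniform in `ε`
(r14's `B2StepK.rDecayBeatsPowers`, (2.109)/(2.7): `r > 1`, `R > 0`) — the printed *"O(ε^κ)"*.  With the level-`0` constants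
of §3 (which are NOT `ε`-uniform, HONEST SCOPE (b)): `norm_condShiftField_zero_le_far_levelZero`. -/

section Far

variable (C : ChargeData N) (Ω : Finset (HiggsLattice.Site P 0)) (A : HiggsLattice.VecField P 0) (msq a : ℝ)

/-- **The (2.30) shift bounded through the SOURCES only**: with an entrywise domination `‖C^{(0)}_Λ(x, x′)v‖ ≤ c(x, x′)‖v‖` and
`‖φ′‖ ≤ p` on `∂Λ₅` (`Λ₅ = B(Λ′)`), `‖(second term of (2.30))(x)‖ ≤ ε⁻²·(Σ_{b∈stFwd} c(x, b.src) + Σ_{b∈stBwd} c(x, b.tgt))·p`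
(the mechanism of `B2Eq230CondShift.norm_condShiftField_zero_le` before its coarsening to all bonds). [cite: Balaban1982Higgs2, (2.30) p.563] -/
theorem norm_condShiftField_zero_le_sources (Λ' : Finset (HiggsLattice.Site P 1)) {φ : ScalarField P 0 N}
    {c : HiggsLattice.Site P 0 → HiggsLattice.Site P 0 → ℝ} {p : ℝ}
    (hK : ∀ (x x' : HiggsLattice.Site P 0) (v : E N),
      ‖kernel (condCov232 C Ω A msq a 0 (HiggsLattice.blockSet Λ')) x x' v‖ ≤ c x x' * ‖v‖)
    (hc : ∀ x x', 0 ≤ c x x')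
    (hφ : ∀ y ∈ bdrySites Ω (HiggsLattice.blockSet Λ'), ‖φ y‖ ≤ p) (x : HiggsLattice.Site P 0) :
    ‖condShiftField C Ω A msq a 0 (HiggsLattice.blockSet Λ') φ x‖
      ≤ (P.mesh 0)⁻¹ ^ 2 * ((∑ b ∈ stFwd Ω (HiggsLattice.blockSet Λ'), c x b.src)
          + ∑ b ∈ stBwd Ω (HiggsLattice.blockSet Λ'), c x b.tgt) * p := by
  rw [condShiftField_zero_apply, norm_smul, Real.norm_of_nonneg (pow_nonneg (inv_nonneg.mpr (P.mesh_pos 0).le) 2)]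
  have hU : ∀ (s : ℝ) (v : E N), ‖C.U (P.mesh 0) s v‖ = ‖v‖ := fun s v =>
    ContinuousLinearMap.norm_map_of_mem_unitary (C.U_mem_unitary (P.mesh 0) s) v
  have hF : ‖∑ b ∈ stFwd Ω (HiggsLattice.blockSet Λ'),
        kernel (condCov232 C Ω A msq a 0 (HiggsLattice.blockSet Λ')) x b.src (C.U (P.mesh 0) (A b) (φ b.tgt))‖
      ≤ (∑ b ∈ stFwd Ω (HiggsLattice.blockSet Λ'), c x b.src) * p := by
    calc ‖∑ b ∈ stFwd Ω (HiggsLattice.blockSet Λ'),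
            kernel (condCov232 C Ω A msq a 0 (HiggsLattice.blockSet Λ')) x b.src (C.U (P.mesh 0) (A b) (φ b.tgt))‖
        ≤ ∑ b ∈ stFwd Ω (HiggsLattice.blockSet Λ'),
            ‖kernel (condCov232 C Ω A msq a 0 (HiggsLattice.blockSet Λ')) x b.src (C.U (P.mesh 0) (A b) (φ b.tgt))‖ :=
          norm_sum_le _ _
      _ ≤ ∑ b ∈ stFwd Ω (HiggsLattice.blockSet Λ'), c x b.src * p := by
          refine Finset.sum_le_sum fun b hb => (hK x b.src _).trans ?_
          rw [hU]
          exact mul_le_mul_of_nonneg_left (hφ b.tgt (tgt_mem_bdrySites hb)) (hc x b.src)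
      _ = (∑ b ∈ stFwd Ω (HiggsLattice.blockSet Λ'), c x b.src) * p := by rw [Finset.sum_mul]
  have hB : ‖∑ b ∈ stBwd Ω (HiggsLattice.blockSet Λ'),
        kernel (condCov232 C Ω A msq a 0 (HiggsLattice.blockSet Λ')) x b.tgt (C.U (P.mesh 0) (-(A b)) (φ b.src))‖
      ≤ (∑ b ∈ stBwd Ω (HiggsLattice.blockSet Λ'), c x b.tgt) * p := by
    calc ‖∑ b ∈ stBwd Ω (HiggsLattice.blockSet Λ'),
            kernel (condCov232 C Ω A msq a 0 (HiggsLattice.blockSet Λ')) x b.tgt (C.U (P.mesh 0) (-(A b)) (φ b.src))‖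
        ≤ ∑ b ∈ stBwd Ω (HiggsLattice.blockSet Λ'),
            ‖kernel (condCov232 C Ω A msq a 0 (HiggsLattice.blockSet Λ')) x b.tgt (C.U (P.mesh 0) (-(A b)) (φ b.src))‖ :=
          norm_sum_le _ _
      _ ≤ ∑ b ∈ stBwd Ω (HiggsLattice.blockSet Λ'), c x b.tgt * p := by
          refine Finset.sum_le_sum fun b hb => (hK x b.tgt _).trans ?_
          rw [hU]
          exact mul_le_mul_of_nonneg_left (hφ b.src (src_mem_bdrySites hb)) (hc x b.tgt)
      _ = (∑ b ∈ stBwd Ω (HiggsLattice.blockSet Λ'), c x b.tgt) * p := by rw [Finset.sum_mul]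
  calc (P.mesh 0)⁻¹ ^ 2 * ‖∑ b ∈ stFwd Ω (HiggsLattice.blockSet Λ'),
            kernel (condCov232 C Ω A msq a 0 (HiggsLattice.blockSet Λ')) x b.src (C.U (P.mesh 0) (A b) (φ b.tgt))
          + ∑ b ∈ stBwd Ω (HiggsLattice.blockSet Λ'),
            kernel (condCov232 C Ω A msq a 0 (HiggsLattice.blockSet Λ')) x b.tgt (C.U (P.mesh 0) (-(A b)) (φ b.src))‖
      ≤ (P.mesh 0)⁻¹ ^ 2 * ((∑ b ∈ stFwd Ω (HiggsLattice.blockSet Λ'), c x b.src) * p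
          + (∑ b ∈ stBwd Ω (HiggsLattice.blockSet Λ'), c x b.tgt) * p) := by
        refine mul_le_mul_of_nonneg_left ((norm_add_le _ _).trans (add_le_add hF hB)) ?_
        exact pow_nonneg (inv_nonneg.mpr (P.mesh_pos 0).le) 2
    _ = (P.mesh 0)⁻¹ ^ 2 * ((∑ b ∈ stFwd Ω (HiggsLattice.blockSet Λ'), c x b.src)
          + ∑ b ∈ stBwd Ω (HiggsLattice.blockSet Λ'), c x b.tgt) * p := by ring

/-- Half of an exponential decay spent on a distance lower bound: `e^{−δt} ≤ e^{−(δ/2)m}·e^{−(δ/2)t}` for `t ≥ m`, `δ ≥ 0`.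
[cite: Balaban1982Higgs2, (2.30) p.563] -/
private theorem exp_neg_mul_le_split {δ t m : ℝ} (hδ : 0 ≤ δ) (ht : m ≤ t) :
    Real.exp (-(δ * t)) ≤ Real.exp (-(δ / 2 * m)) * Real.exp (-(δ / 2 * t)) := by
  rw [← Real.exp_add, Real.exp_le_exp]
  nlinarith

/-- The sources of the forward boundary bonds are at distance `≥ D − 1` from a site at distance `≥ D` from `Λ₅ᶜ`
(`b₊ ∉ Λ₅`, `|b₋ − b₊| ≤ 1`). [cite: Balaban1982Higgs2, (2.29) p.563] -/
theorem le_tdist_src_of_mem_stFwd {Λ : Finset (HiggsLattice.Site P k)} {Ω' : Finset (HiggsLattice.Site P k)} {x : HiggsLattice.Site P k}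
    {D : ℝ} (hD : ∀ y : HiggsLattice.Site P k, y ∉ Λ → D ≤ (HiggsLattice.Site.tdist x y : ℝ))
    {b : HiggsLattice.PBond P k} (hb : b ∈ stFwd Ω' Λ) : D - 1 ≤ (HiggsLattice.Site.tdist x b.src : ℝ) := by
  have htgt : b.tgt ∉ Λ := ((mem_stFwd Ω' Λ b).mp hb).2.2.2
  have h1 : (HiggsLattice.Site.tdist b.src b.tgt : ℝ) ≤ 1 := by
    exact_mod_cast B1Ineq234LevelZero.tdist_shift_le_one b.src b.dir
  have htri := B1Ineq234LevelZero.tdist_triangle_real x b.src b.tgt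
  have := hD b.tgt htgt
  linarith

/-- The sources of the backward boundary bonds (`b₋ = b.tgt ∈ Λ₅`, `b₊ = b.src ∉ Λ₅`) are at distance `≥ D − 1` likewise.
[cite: Balaban1982Higgs2, (2.29) p.563] -/
theorem le_tdist_tgt_of_mem_stBwd {Λ : Finset (HiggsLattice.Site P k)} {Ω' : Finset (HiggsLattice.Site P k)} {x : HiggsLattice.Site P k}
    {D : ℝ} (hD : ∀ y : HiggsLattice.Site P k, y ∉ Λ → D ≤ (HiggsLattice.Site.tdist x y : ℝ))
    {b : HiggsLattice.PBond P k} (hb : b ∈ stBwd Ω' Λ) : D - 1 ≤ (HiggsLattice.Site.tdist x b.tgt : ℝ) := by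
  have hsrc : b.src ∉ Λ := ((mem_stBwd Ω' Λ b).mp hb).2.2.2
  have h1 : (HiggsLattice.Site.tdist b.tgt b.src : ℝ) ≤ 1 := by
    rw [B1Ineq234LevelZero.tdist_comm]
    exact_mod_cast B1Ineq234LevelZero.tdist_shift_le_one b.src b.dir
  have htri := B1Ineq234LevelZero.tdist_triangle_real x b.tgt b.src
  have := hD b.src hsrc
  linarith

/-- **The (2.30) shift away from the boundary**: with an exponentially decaying domination `‖C^{(0)}_Λ(x, x′)v‖ ≤ c₁e^{−δ₁|x − x′|}‖v‖`
(`c₁ ≥ 0`, `δ₁ > 0`), `‖φ′‖ ≤ p` on `∂Λ₅`, and a site `x` at distance `≥ D` from every point outside `Λ₅ = B(Λ′)`: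
`‖(second term of (2.30))(x)‖ ≤ ε⁻²·(2d·c₁·K_d(δ₁/2)·e^{−(δ₁/2)(D − 1)})·p` — exponentially small in the distance from `∂Λ₅`.
[cite: Balaban1982Higgs2, (2.30) p.563] -/
theorem norm_condShiftField_zero_le_far (Λ' : Finset (HiggsLattice.Site P 1)) {φ : ScalarField P 0 N} {c₁ δ₁ p D : ℝ}
    (hc₁ : 0 ≤ c₁) (hδ₁ : 0 < δ₁)
    (hK : ∀ (x x' : HiggsLattice.Site P 0) (v : E N),
      ‖kernel (condCov232 C Ω A msq a 0 (HiggsLattice.blockSet Λ')) x x' v‖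
        ≤ c₁ * Real.exp (-(δ₁ * (HiggsLattice.Site.tdist x x' : ℝ))) * ‖v‖)
    (hp : 0 ≤ p) (hφ : ∀ y ∈ bdrySites Ω (HiggsLattice.blockSet Λ'), ‖φ y‖ ≤ p) (x : HiggsLattice.Site P 0)
    (hD : ∀ y : HiggsLattice.Site P 0, y ∉ HiggsLattice.blockSet Λ' → D ≤ (HiggsLattice.Site.tdist x y : ℝ)) :
    ‖condShiftField C Ω A msq a 0 (HiggsLattice.blockSet Λ') φ x‖
      ≤ (P.mesh 0)⁻¹ ^ 2 * (2 * (P.d : ℝ) * c₁ * B4Sect5Proof.latticeConst P.d (δ₁ / 2)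
          * Real.exp (-(δ₁ / 2 * (D - 1)))) * p := by
  have hδ2 : 0 < δ₁ / 2 := by linarith
  have hS := sum_exp_neg_tdist_le (P := P) (k := 0) hδ2 x
  set K := B4Sect5Proof.latticeConst P.d (δ₁ / 2) with hKdef
  set E := Real.exp (-(δ₁ / 2 * (D - 1))) with hEdef
  have hE : 0 ≤ E := (Real.exp_pos _).le
  have h0 := norm_condShiftField_zero_le_sources C Ω A msq a Λ' hK
    (fun x x' => mul_nonneg hc₁ (Real.exp_pos _).le) hφ x
  -- the forward sources
  have hF : ∑ b ∈ stFwd Ω (HiggsLattice.blockSet Λ'), c₁ * Real.exp (-(δ₁ * (HiggsLattice.Site.tdist x b.src : ℝ)))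
      ≤ c₁ * E * ((P.d : ℝ) * K) := by
    calc ∑ b ∈ stFwd Ω (HiggsLattice.blockSet Λ'), c₁ * Real.exp (-(δ₁ * (HiggsLattice.Site.tdist x b.src : ℝ)))
        ≤ ∑ b ∈ stFwd Ω (HiggsLattice.blockSet Λ'), c₁ * (E * Real.exp (-(δ₁ / 2 * (HiggsLattice.Site.tdist x b.src : ℝ)))) :=
          Finset.sum_le_sum fun b hb => mul_le_mul_of_nonneg_left
            (exp_neg_mul_le_split hδ₁.le (le_tdist_src_of_mem_stFwd hD hb)) hc₁
      _ ≤ ∑ b : HiggsLattice.PBond P 0, c₁ * (E * Real.exp (-(δ₁ / 2 * (HiggsLattice.Site.tdist x b.src : ℝ)))) :=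
          Finset.sum_le_univ_sum_of_nonneg fun b => mul_nonneg hc₁ (mul_nonneg hE (Real.exp_pos _).le)
      _ = c₁ * E * ((P.d : ℝ) * ∑ x' : HiggsLattice.Site P 0, Real.exp (-(δ₁ / 2 * (HiggsLattice.Site.tdist x x' : ℝ)))) := by
          rw [← sum_pbond_src (fun y => Real.exp (-(δ₁ / 2 * (HiggsLattice.Site.tdist x y : ℝ))))]
          simp only [Finset.mul_sum]
          exact Finset.sum_congr rfl fun b _ => by ring
      _ ≤ c₁ * E * ((P.d : ℝ) * K) :=
          mul_le_mul_of_nonneg_left (mul_le_mul_of_nonneg_left hS (Nat.cast_nonneg _)) (mul_nonneg hc₁ hE)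
  -- the backward sources
  have hB : ∑ b ∈ stBwd Ω (HiggsLattice.blockSet Λ'), c₁ * Real.exp (-(δ₁ * (HiggsLattice.Site.tdist x b.tgt : ℝ)))
      ≤ c₁ * E * ((P.d : ℝ) * K) := by
    calc ∑ b ∈ stBwd Ω (HiggsLattice.blockSet Λ'), c₁ * Real.exp (-(δ₁ * (HiggsLattice.Site.tdist x b.tgt : ℝ)))
        ≤ ∑ b ∈ stBwd Ω (HiggsLattice.blockSet Λ'), c₁ * (E * Real.exp (-(δ₁ / 2 * (HiggsLattice.Site.tdist x b.tgt : ℝ)))) :=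
          Finset.sum_le_sum fun b hb => mul_le_mul_of_nonneg_left
            (exp_neg_mul_le_split hδ₁.le (le_tdist_tgt_of_mem_stBwd hD hb)) hc₁
      _ ≤ ∑ b : HiggsLattice.PBond P 0, c₁ * (E * Real.exp (-(δ₁ / 2 * (HiggsLattice.Site.tdist x b.tgt : ℝ)))) :=
          Finset.sum_le_univ_sum_of_nonneg fun b => mul_nonneg hc₁ (mul_nonneg hE (Real.exp_pos _).le)
      _ = c₁ * E * ((P.d : ℝ) * ∑ x' : HiggsLattice.Site P 0, Real.exp (-(δ₁ / 2 * (HiggsLattice.Site.tdist x x' : ℝ)))) := by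
          rw [← sum_pbond_tgt (fun y => Real.exp (-(δ₁ / 2 * (HiggsLattice.Site.tdist x y : ℝ))))]
          simp only [Finset.mul_sum]
          exact Finset.sum_congr rfl fun b _ => by ring
      _ ≤ c₁ * E * ((P.d : ℝ) * K) :=
          mul_le_mul_of_nonneg_left (mul_le_mul_of_nonneg_left hS (Nat.cast_nonneg _)) (mul_nonneg hc₁ hE)
  have hε : 0 ≤ (P.mesh 0)⁻¹ ^ 2 := pow_nonneg (inv_nonneg.mpr (P.mesh_pos 0).le) 2
  refine h0.trans ?_
  have hsum := add_le_add hF hB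
  calc (P.mesh 0)⁻¹ ^ 2 * ((∑ b ∈ stFwd Ω (HiggsLattice.blockSet Λ'), c₁ * Real.exp (-(δ₁ * (HiggsLattice.Site.tdist x b.src : ℝ))))
          + ∑ b ∈ stBwd Ω (HiggsLattice.blockSet Λ'), c₁ * Real.exp (-(δ₁ * (HiggsLattice.Site.tdist x b.tgt : ℝ)))) * p
      ≤ (P.mesh 0)⁻¹ ^ 2 * (c₁ * E * ((P.d : ℝ) * K) + c₁ * E * ((P.d : ℝ) * K)) * p :=
        mul_le_mul_of_nonneg_right (mul_le_mul_of_nonneg_left hsum hε) hp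
    _ = (P.mesh 0)⁻¹ ^ 2 * (2 * (P.d : ℝ) * c₁ * K * E) * p := by ring

/-- **… hence `≤ ε⁻²·(2d·c₁·K_d(δ₁/2))·e^{−(δ₁/2)ρ}·p` whenever `dist(x, Λ₅ᶜ) ≥ ρ + 1`** — for `x ∈ Λ₇` the separation (2.8)
gives `ρ = r(ε)` (`B2Eq28RegionsConcrete.sep_region`), and `e^{−(δ₁/2)r(ε)} ≤ C_κ ε^κ` for every `κ` when `δ₁` does not depend
on `ε` (r14's `B2StepK.rDecayBeatsPowers`): the printed *"of the order O(ε^κ)"*. [cite: Balaban1982Higgs2, (2.30) p.563] -/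
theorem norm_condShiftField_zero_le_far_of_le (Λ' : Finset (HiggsLattice.Site P 1)) {φ : ScalarField P 0 N} {c₁ δ₁ p D ρ : ℝ}
    (hc₁ : 0 ≤ c₁) (hδ₁ : 0 < δ₁)
    (hK : ∀ (x x' : HiggsLattice.Site P 0) (v : E N),
      ‖kernel (condCov232 C Ω A msq a 0 (HiggsLattice.blockSet Λ')) x x' v‖
        ≤ c₁ * Real.exp (-(δ₁ * (HiggsLattice.Site.tdist x x' : ℝ))) * ‖v‖)
    (hp : 0 ≤ p) (hφ : ∀ y ∈ bdrySites Ω (HiggsLattice.blockSet Λ'), ‖φ y‖ ≤ p) (x : HiggsLattice.Site P 0)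
    (hD : ∀ y : HiggsLattice.Site P 0, y ∉ HiggsLattice.blockSet Λ' → D ≤ (HiggsLattice.Site.tdist x y : ℝ)) (hρ : ρ + 1 ≤ D) :
    ‖condShiftField C Ω A msq a 0 (HiggsLattice.blockSet Λ') φ x‖
      ≤ (P.mesh 0)⁻¹ ^ 2 * (2 * (P.d : ℝ) * c₁ * B4Sect5Proof.latticeConst P.d (δ₁ / 2)
          * Real.exp (-(δ₁ / 2 * ρ))) * p := by
  refine (norm_condShiftField_zero_le_far C Ω A msq a Λ' hc₁ hδ₁ hK hp hφ x hD).trans ?_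
  have hε : 0 ≤ (P.mesh 0)⁻¹ ^ 2 := pow_nonneg (inv_nonneg.mpr (P.mesh_pos 0).le) 2
  have hKd : 0 ≤ B4Sect5Proof.latticeConst P.d (δ₁ / 2) :=
    le_trans (Finset.sum_nonneg fun _ _ => (Real.exp_pos _).le) (sum_exp_neg_tdist_le (P := P) (k := 0) (by linarith) x)
  have hexp : Real.exp (-(δ₁ / 2 * (D - 1))) ≤ Real.exp (-(δ₁ / 2 * ρ)) := Real.exp_le_exp.mpr (by nlinarith)
  have h2 : 0 ≤ 2 * (P.d : ℝ) * c₁ * B4Sect5Proof.latticeConst P.d (δ₁ / 2) := by positivity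
  exact mul_le_mul_of_nonneg_right (mul_le_mul_of_nonneg_left (mul_le_mul_of_nonneg_left hexp h2) hε) hp

/-- **With the level-`0` constants of §3** (`c₁ = N·cSt(…)`, `δ₁ = dSt(…)`, for `m² > 0`, `a ≥ 0`, `0 < K`, `δ > 0`; explicit
but not `ε`-uniform, HONEST SCOPE (b)): the (2.30) shift at a site `x` at distance `≥ D` from `Λ₅ᶜ` is
`≤ ε⁻²·(2d·N·c₁·K_d(δ₁/2)·e^{−(δ₁/2)(D−1)})·p`. [cite: Balaban1982Higgs2, (2.30) p.563] -/
theorem norm_condShiftField_zero_le_far_levelZero (hK : 0 < P.K) (ha : 0 ≤ a) (hmsq : 0 < msq) {δ : ℝ} (hδ : 0 < δ)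
    (Λ' : Finset (HiggsLattice.Site P 1)) {φ : ScalarField P 0 N} {p D : ℝ} (hp : 0 ≤ p)
    (hφ : ∀ y ∈ bdrySites Ω (HiggsLattice.blockSet Λ'), ‖φ y‖ ≤ p) (x : HiggsLattice.Site P 0)
    (hD : ∀ y : HiggsLattice.Site P 0, y ∉ HiggsLattice.blockSet Λ' → D ≤ (HiggsLattice.Site.tdist x y : ℝ)) :
    ‖condShiftField C Ω A msq a 0 (HiggsLattice.blockSet Λ') φ x‖
      ≤ (P.mesh 0)⁻¹ ^ 2 * (2 * (P.d : ℝ) * ((N : ℝ) * cSt (profile P N) msq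
              (a * ((P.mesh (0 + 1))⁻¹ ^ 2) * Real.exp (δ * ((P.L : ℝ) - 1)) +
                (4 * P.d * (P.mesh 0)⁻¹ ^ 2 + msq) * Real.exp δ) δ)
          * B4Sect5Proof.latticeConst P.d (dSt (profile P N) msq
              (a * ((P.mesh (0 + 1))⁻¹ ^ 2) * Real.exp (δ * ((P.L : ℝ) - 1)) +
                (4 * P.d * (P.mesh 0)⁻¹ ^ 2 + msq) * Real.exp δ) δ / 2)
          * Real.exp (-(dSt (profile P N) msq
              (a * ((P.mesh (0 + 1))⁻¹ ^ 2) * Real.exp (δ * ((P.L : ℝ) - 1)) +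
                (4 * P.d * (P.mesh 0)⁻¹ ^ 2 + msq) * Real.exp δ) δ / 2 * (D - 1)))) * p :=
  norm_condShiftField_zero_le_far C Ω A msq a Λ'
    (mul_nonneg (Nat.cast_nonneg N) (cSt_levelZero_pos (P := P) (N := N) msq a hmsq δ).le)
    (dSt_levelZero_pos (P := P) (N := N) msq a ha hmsq hδ)
    (fun x x' v => by
      have h := norm_kernel_condCov232_levelZero_le C Ω A msq a hK ha hmsq hδ (HiggsLattice.blockSet Λ') x x' v
      calc _ ≤ _ := h
        _ = _ := by ring)
    hp hφ x hD

end Far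

end Literature.MathematicalPhysics.QuantumFieldTheory.Balaban1983to89.B2Eq230CondShiftBound
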